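import Summits.Parity.GeneralizedHardyLittlewood.Theorems.LiouvilleMADTypeIIToLevelTypeIIBox
import Literature.NumberTheory.Sieve.VaughanMeanValueDecomposition

/-!
# `TypeIIToLevel` (route `LiouvilleMAD`), part 3b: the rectangle type-II hypothesis for a class weight

Support file for the item stmt-Parity-14996
(`Summit.Parity.GeneralizedHardyLittlewood.Theses.LiouvilleMAD.TypeIIToLevel`).  Continues part 3a
(`LiouvilleMADTypeIIToLevelTypeIIBox`: class splitting on dyadic boxes).

Output (`typeII_rect`): for `Φ : ℕ → ℝ` with `|Φ| ≤ 1` and the dyadic bilinear bound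
`|∑_{m ∈ (M,2M]} ∑_{n ∈ (N,2N]} α(m) β(n) Φ(mn)| ≤ C ‖α‖₂ ‖β‖₂ (MN)^{1/2} (N^{−1/2} + M^{−η})` (`1 ≤ N ≤ M`),
the CLASS weight `lam(k) = 1[k ≡ w (q)] Φ(k)` and `U ≥ 2` satisfy the rectangle hypothesis of the Vaughan
engine (`LiouvilleMADTypeIIToLevelEngine`): `|∑_{D₁ < d ≤ D₂} a(d) ∑_{m ≤ N} b(m) lam(dm)| ≤ A B W D₁ N` for
`U ≤ D₁ ≤ D₂ ≤ 2D₁`, `U/2 ≤ N`, `|a| ≤ A`, `|b| ≤ B`, with `W = (10C + 1) q ((U/2)^{−η'} + U^{−η'})`,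
`η' = min η 1/2`.  Steps: the dyadic decomposition `(0, N] = {1} ⊔ ⨆_i ((2^i, 2^{i+1}] ∩ (0, N])`
(`sum_Ioc_eq_head_add_dyadic`), a geometric sum (`sum_range_rpow_two_pow_le`), and `abs_box_le` on each piece.
-/

noncomputable section

open Finset Real

namespace Summit.Parity.GeneralizedHardyLittlewood.Theorems.TypeIIToLevel

/-! ### The dyadic decomposition of `(0, N]` -/

/-- `(0, N] = {1} ⊔ ⨆_{i ≤ log₂ N} ((2^i, 2^{i+1}] ∩ (0, N])`, as a sum identity. [folklore] -/
theorem sum_Ioc_eq_head_add_dyadic (g : ℕ → ℝ) {N : ℕ} (hN : 1 ≤ N) :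
    ∑ m ∈ Ioc 0 N, g m = g 1 + ∑ i ∈ range (Nat.log 2 N + 1),
      ∑ m ∈ Ioc (2 ^ i) (2 * 2 ^ i), if m ≤ N then g m else 0 := by
  set L := Nat.log 2 N + 1 with hL
  have hNL : N < 2 ^ L := Nat.lt_pow_succ_log_self one_lt_two N
  have h1 : ∑ m ∈ Ioc 0 N, g m = ∑ m ∈ Ioc 0 (2 ^ L), if m ≤ N then g m else 0 := by
    rw [← sum_filter]
    refine sum_congr ?_ fun _ _ => rfl
    ext m; simp only [mem_Ioc, mem_filter]; omega
  rw [h1, ← sum_Ioc_consecutive _ (Nat.zero_le 1) (Nat.one_le_two_pow), show (2 ^ L : ℕ) = 1 * 2 ^ L by ring,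
    Literature.NumberTheory.Sieve.Vaughan.sum_Ioc_mul_two_pow_eq_sum _ 1 L]
  congr 1
  · rw [show Ioc 0 1 = {1} by rfl, sum_singleton, if_pos hN]
  · refine sum_congr rfl fun i _ => ?_
    rw [one_mul, ← two_mul]

/-- A geometric sum: `∑_{i ≤ log₂ N} (2^i)^{1−s} ≤ 5 N^{1−s}` for `0 < s ≤ 1/2`, `N ≥ 1`. [folklore] -/
theorem sum_range_rpow_two_pow_le {s : ℝ} (hs0 : 0 ≤ s) (hs : s ≤ 1 / 2) {N : ℕ} (hN : 1 ≤ N) :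
    ∑ i ∈ range (Nat.log 2 N + 1), ((2 : ℝ) ^ i) ^ (1 - s) ≤ 5 * (N : ℝ) ^ (1 - s) := by
  set L := Nat.log 2 N with hL
  set r : ℝ := (2 : ℝ) ^ (1 - s) with hr
  have h2 : (0 : ℝ) ≤ 2 := by norm_num
  have hterm : ∀ i : ℕ, ((2 : ℝ) ^ i) ^ (1 - s) = r ^ i := by
    intro i
    rw [hr, ← Real.rpow_natCast 2 i, ← Real.rpow_mul h2, mul_comm, Real.rpow_mul h2, Real.rpow_natCast]
  simp_rw [hterm]
  -- `r ≥ 2^{1/2} ≥ 7/5`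
  have hr75 : (7 / 5 : ℝ) ≤ r := by
    have h1 : (7 / 5 : ℝ) ≤ (2 : ℝ) ^ (1 / 2 : ℝ) := by
      rw [← Real.sqrt_eq_rpow, Real.le_sqrt (by norm_num)] <;> norm_num
    exact h1.trans (Real.rpow_le_rpow_of_exponent_le (by norm_num) (by linarith))
  have hr1 : 1 < r := by linarith
  have hr2 : r ≤ 2 := by
    calc r ≤ (2 : ℝ) ^ (1 : ℝ) := Real.rpow_le_rpow_of_exponent_le (by norm_num) (by linarith [hs0])
      _ = 2 := Real.rpow_one 2
  -- `r^L ≤ N^{1-s}`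
  have hrL : r ^ L ≤ (N : ℝ) ^ (1 - s) := by
    rw [← hterm L]
    have h2L : ((2 : ℝ) ^ L) ≤ N := by exact_mod_cast Nat.pow_log_le_self 2 (by omega : N ≠ 0)
    exact Real.rpow_le_rpow (by positivity) h2L (by linarith)
  rw [geom_sum_eq hr1.ne', div_le_iff₀ (by linarith), pow_succ]
  have hN0 : 0 ≤ (N : ℝ) ^ (1 - s) := by positivity
  nlinarith [pow_nonneg (zero_le_one.trans hr1.le) L]

/-! ### The rectangle hypothesis for a class weight -/

/-- **The rectangle type-II hypothesis for the class weight `lam = 1[· ≡ w (q)] Φ`** (the shape consumed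
by `abs_sum_vonMangoldt_mul_le_param`): for `U ≥ 2`, `U ≤ D₁ ≤ D₂ ≤ 2D₁`, `U/2 ≤ N`, `|a| ≤ A` on
`(D₁, D₂]`, `|b| ≤ B` on `(0, N]`,
`|∑_{D₁<d≤D₂} a(d) ∑_{m≤N} b(m) lam(dm)| ≤ A B W D₁ N`, `W = (10C+1) q ((U/2)^{−η'} + U^{−η'})`,
`η' = min η (1/2)` (dyadic pieces in `m` by `abs_box_le`, the piece `m = 1` and the tails trivially).
[folklore] -/
theorem typeII_rect {Φ : ℕ → ℝ} {η C : ℝ} (hη : 0 < η) (hC : 0 ≤ C) (hΦ1 : ∀ n, |Φ n| ≤ 1)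
    (hΦ : ∀ M N : ℕ, 1 ≤ N → N ≤ M → ∀ α β : ℕ → ℝ,
      |∑ m ∈ Ioc M (2 * M), ∑ n ∈ Ioc N (2 * N), α m * β n * Φ (m * n)| ≤
        C * Real.sqrt (∑ m ∈ Ioc M (2 * M), α m ^ 2) * Real.sqrt (∑ n ∈ Ioc N (2 * N), β n ^ 2) *
          (Real.sqrt ((M : ℝ) * N) * ((N : ℝ) ^ (-(1 / 2 : ℝ)) + (M : ℝ) ^ (-η))))
    {q : ℕ} (hq : 0 < q) (w : ℕ) {U : ℕ} (hU : 2 ≤ U) :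
    ∀ D₁ D₂ N : ℕ, U ≤ D₁ → D₁ ≤ D₂ → D₂ ≤ 2 * D₁ → U / 2 ≤ N →
      ∀ A B : ℝ, 0 ≤ A → 0 ≤ B → ∀ a b : ℕ → ℝ,
        (∀ d ∈ Ioc D₁ D₂, |a d| ≤ A) → (∀ m ∈ Ioc 0 N, |b m| ≤ B) →
        |∑ d ∈ Ioc D₁ D₂, a d * ∑ m ∈ Ioc 0 N, b m * (if d * m ≡ w [MOD q] then Φ (d * m) else 0)| ≤
          A * B * ((10 * C + 1) * q * ((((U / 2 : ℕ) : ℝ)) ^ (-(min η (1 / 2))) +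
            (U : ℝ) ^ (-(min η (1 / 2))))) * D₁ * N := by
  intro D₁ D₂ N hUD hD12 hD2 hVN A B hA hB a b ha hb
  set η' : ℝ := min η (1 / 2) with hη'
  have hη'0 : 0 < η' := lt_min hη (by norm_num)
  have hη'η : η' ≤ η := min_le_left _ _
  have hη'h : η' ≤ 1 / 2 := min_le_right _ _
  have hD₁1 : 1 ≤ D₁ := le_trans (by omega) hUD
  have hN1 : 1 ≤ N := le_trans (by omega : 1 ≤ U / 2) hVN
  have hD₁0 : (0 : ℝ) < D₁ := by exact_mod_cast hD₁1
  have hN0 : (0 : ℝ) < N := by exact_mod_cast hN1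
  have hq1 : (1 : ℝ) ≤ q := by exact_mod_cast hq
  -- the class weight and the coefficients, extended by zero
  set c : ℕ → ℕ → ℝ := fun d m => if d * m ≡ w [MOD q] then Φ (d * m) else 0 with hc
  have hc1 : ∀ d m, |c d m| ≤ 1 := by
    intro d m; simp only [hc]; split_ifs
    · exact hΦ1 _
    · simp
  set a' : ℕ → ℝ := fun d => if d ∈ Ioc D₁ D₂ then a d else 0 with ha'
  set b' : ℕ → ℝ := fun m => if m ≤ N then b m else 0 with hb'
  have ha'A : ∀ d, |a' d| ≤ A := by
    intro d; simp only [ha']; split_ifs with h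
    · exact ha d h
    · simpa using hA
  have hb'B : ∀ m, 1 ≤ m → |b' m| ≤ B := by
    intro m hm; simp only [hb']; split_ifs with h
    · exact hb m (mem_Ioc.2 ⟨hm, h⟩)
    · simpa using hB
  -- Step 1: dyadic decomposition of the inner sums and extension of the outer range
  set L := Nat.log 2 N + 1 with hL
  have hinner : ∀ d, ∑ m ∈ Ioc 0 N, b m * c d m =
      b 1 * c d 1 + ∑ i ∈ range L, ∑ m ∈ Ioc (2 ^ i) (2 * 2 ^ i), b' m * c d m := by
    intro d
    rw [sum_Ioc_eq_head_add_dyadic (fun m => b m * c d m) hN1]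
    congr 1
    refine sum_congr rfl fun i _ => sum_congr rfl fun m _ => ?_
    simp only [hb']
    split_ifs <;> simp
  have houter : ∑ d ∈ Ioc D₁ D₂, a d * ∑ m ∈ Ioc 0 N, b m * c d m =
      ∑ d ∈ Ioc D₁ (2 * D₁), a' d * ∑ m ∈ Ioc 0 N, b m * c d m := by
    symm
    rw [← sum_subset (Ioc_subset_Ioc_right hD2)]
    · refine sum_congr rfl fun d hd => ?_
      simp only [ha']; rw [if_pos hd]
    · intro d _ hd
      simp only [ha']; rw [if_neg hd, zero_mul]
  have hsplit : ∑ d ∈ Ioc D₁ (2 * D₁), a' d * ∑ m ∈ Ioc 0 N, b m * c d m =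
      ∑ d ∈ Ioc D₁ (2 * D₁), a' d * (b 1 * c d 1) +
        ∑ i ∈ range L, ∑ d ∈ Ioc D₁ (2 * D₁), ∑ m ∈ Ioc (2 ^ i) (2 * 2 ^ i), a' d * b' m * c d m := by
    simp_rw [hinner, mul_add, sum_add_distrib]
    congr 1
    rw [sum_comm]
    refine sum_congr rfl fun d _ => ?_
    rw [mul_sum]
    refine sum_congr rfl fun i _ => ?_
    rw [mul_sum]
    refine sum_congr rfl fun m _ => ?_
    ring
  change |∑ d ∈ Ioc D₁ D₂, a d * ∑ m ∈ Ioc 0 N, b m * c d m| ≤ _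
  rw [houter, hsplit]
  -- Step 2: the head `m = 1`
  have hb1 : |b 1| ≤ B := hb 1 (mem_Ioc.2 ⟨zero_lt_one, hN1⟩)
  have hhead : |∑ d ∈ Ioc D₁ (2 * D₁), a' d * (b 1 * c d 1)| ≤ A * B * D₁ := by
    calc |∑ d ∈ Ioc D₁ (2 * D₁), a' d * (b 1 * c d 1)| ≤ ∑ d ∈ Ioc D₁ (2 * D₁), A * (B * 1) := by
          refine (abs_sum_le_sum_abs _ _).trans (sum_le_sum fun d _ => ?_)
          rw [abs_mul, abs_mul]
          exact mul_le_mul (ha'A d) (mul_le_mul hb1 (hc1 d 1) (abs_nonneg _) hB) (by positivity) hA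
      _ = A * B * D₁ := by
          rw [sum_const, Nat.card_Ioc, nsmul_eq_mul]
          rw [show ((2 * D₁ - D₁ : ℕ) : ℝ) = D₁ by rw [show 2 * D₁ - D₁ = D₁ by omega]]
          ring
  -- Step 3: each dyadic piece by `abs_box_le`
  have hnormA : Real.sqrt (∑ d ∈ Ioc D₁ (2 * D₁), a' d ^ 2) ≤ A * Real.sqrt D₁ := by
    calc Real.sqrt (∑ d ∈ Ioc D₁ (2 * D₁), a' d ^ 2) ≤ Real.sqrt (∑ d ∈ Ioc D₁ (2 * D₁), A ^ 2) := by
          refine Real.sqrt_le_sqrt (sum_le_sum fun d _ => ?_)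
          exact sq_le_sq' (abs_le.1 (ha'A d)).1 (abs_le.1 (ha'A d)).2
      _ = A * Real.sqrt D₁ := by
          rw [sum_const, Nat.card_Ioc, nsmul_eq_mul, show 2 * D₁ - D₁ = D₁ by omega,
            Real.sqrt_mul' _ (sq_nonneg A), Real.sqrt_sq hA, mul_comm]
  have hnormB : ∀ i : ℕ, Real.sqrt (∑ m ∈ Ioc (2 ^ i) (2 * 2 ^ i), b' m ^ 2) ≤
      B * Real.sqrt ((2 ^ i : ℕ) : ℝ) := by
    intro i
    calc Real.sqrt (∑ m ∈ Ioc (2 ^ i) (2 * 2 ^ i), b' m ^ 2)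
        ≤ Real.sqrt (∑ m ∈ Ioc (2 ^ i) (2 * 2 ^ i), B ^ 2) := by
          refine Real.sqrt_le_sqrt (sum_le_sum fun m hm => ?_)
          have hm1 : 1 ≤ m := le_trans Nat.one_le_two_pow (mem_Ioc.1 hm).1.le
          exact sq_le_sq' (abs_le.1 (hb'B m hm1)).1 (abs_le.1 (hb'B m hm1)).2
      _ = B * Real.sqrt ((2 ^ i : ℕ) : ℝ) := by
          rw [sum_const, Nat.card_Ioc, nsmul_eq_mul, show 2 * 2 ^ i - 2 ^ i = 2 ^ i by omega,
            Real.sqrt_mul' _ (sq_nonneg B), Real.sqrt_sq hB, mul_comm]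
  have hUpow : ∀ t : ℝ, (U : ℝ) ≤ t → ∀ e : ℝ, η' ≤ e → t ^ (-e) ≤ (U : ℝ) ^ (-η') := by
    intro t ht e he
    have hU1 : (1 : ℝ) ≤ U := by exact_mod_cast (by omega : 1 ≤ U)
    have ht1 : 1 ≤ t := hU1.trans ht
    calc t ^ (-e) ≤ t ^ (-η') := Real.rpow_le_rpow_of_exponent_le ht1 (by linarith)
      _ ≤ (U : ℝ) ^ (-η') := Real.rpow_le_rpow_of_nonpos (by linarith) ht (by linarith)
  have hpiece : ∀ i ∈ range L,
      |∑ d ∈ Ioc D₁ (2 * D₁), ∑ m ∈ Ioc (2 ^ i) (2 * 2 ^ i), a' d * b' m * c d m| ≤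
        2 * C * q * A * B * D₁ * (((2 : ℝ) ^ i) ^ (1 - η') + (2 : ℝ) ^ i * (U : ℝ) ^ (-η')) := by
    intro i _
    have h2i : 1 ≤ 2 ^ i := Nat.one_le_two_pow
    have h2i0 : (0 : ℝ) < ((2 ^ i : ℕ) : ℝ) := by positivity
    have hbox := abs_box_le hC hΦ hq w hD₁1 h2i a' b'
    refine hbox.trans ?_
    have hsq : Real.sqrt ((D₁ : ℝ) * ((2 ^ i : ℕ) : ℝ)) = Real.sqrt D₁ * Real.sqrt ((2 ^ i : ℕ) : ℝ) :=
      Real.sqrt_mul (Nat.cast_nonneg _) _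
    -- the four saving terms against `η'`
    have hcast : (((2 ^ i : ℕ) : ℝ)) = (2 : ℝ) ^ i := by push_cast; ring
    have h2i1 : (1 : ℝ) ≤ (2 : ℝ) ^ i := by exact_mod_cast h2i
    have hs1 : ((2 ^ i : ℕ) : ℝ) ^ (-(1 / 2 : ℝ)) ≤ ((2 : ℝ) ^ i) ^ (-η') := by
      rw [hcast]; exact Real.rpow_le_rpow_of_exponent_le h2i1 (by linarith)
    have hs2 : ((2 ^ i : ℕ) : ℝ) ^ (-η) ≤ ((2 : ℝ) ^ i) ^ (-η') := by
      rw [hcast]; exact Real.rpow_le_rpow_of_exponent_le h2i1 (by linarith)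
    have hs3 : (D₁ : ℝ) ^ (-(1 / 2 : ℝ)) ≤ (U : ℝ) ^ (-η') := hUpow D₁ (by exact_mod_cast hUD) _ hη'h
    have hs4 : (D₁ : ℝ) ^ (-η) ≤ (U : ℝ) ^ (-η') := hUpow D₁ (by exact_mod_cast hUD) _ hη'η
    have hsav : ((2 ^ i : ℕ) : ℝ) ^ (-(1 / 2 : ℝ)) + (D₁ : ℝ) ^ (-η) +
        ((D₁ : ℝ) ^ (-(1 / 2 : ℝ)) + ((2 ^ i : ℕ) : ℝ) ^ (-η)) ≤
        2 * (((2 : ℝ) ^ i) ^ (-η') + (U : ℝ) ^ (-η')) := by linarith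
    have hmass : C * q * Real.sqrt (∑ d ∈ Ioc D₁ (2 * D₁), a' d ^ 2) *
        Real.sqrt (∑ m ∈ Ioc (2 ^ i) (2 * 2 ^ i), b' m ^ 2) * Real.sqrt ((D₁ : ℝ) * ((2 ^ i : ℕ) : ℝ)) ≤
        C * q * (A * Real.sqrt D₁) * (B * Real.sqrt ((2 ^ i : ℕ) : ℝ)) *
          (Real.sqrt D₁ * Real.sqrt ((2 ^ i : ℕ) : ℝ)) := by
      rw [hsq]
      have h0 : 0 ≤ C * q := by positivity
      exact mul_le_mul_of_nonneg_right
        (mul_le_mul (mul_le_mul_of_nonneg_left hnormA h0) (hnormB i) (Real.sqrt_nonneg _) (by positivity))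
        (by positivity)
    have hDD : Real.sqrt (D₁ : ℝ) * Real.sqrt D₁ = D₁ := Real.mul_self_sqrt (Nat.cast_nonneg _)
    have h22 : Real.sqrt ((2 ^ i : ℕ) : ℝ) * Real.sqrt ((2 ^ i : ℕ) : ℝ) = (2 : ℝ) ^ i := by
      rw [Real.mul_self_sqrt h2i0.le, hcast]
    have hpos0 : 0 ≤ ((2 ^ i : ℕ) : ℝ) ^ (-(1 / 2 : ℝ)) + (D₁ : ℝ) ^ (-η) +
        ((D₁ : ℝ) ^ (-(1 / 2 : ℝ)) + ((2 ^ i : ℕ) : ℝ) ^ (-η)) := by positivity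
    calc C * q * Real.sqrt (∑ d ∈ Ioc D₁ (2 * D₁), a' d ^ 2) *
          Real.sqrt (∑ m ∈ Ioc (2 ^ i) (2 * 2 ^ i), b' m ^ 2) *
          (Real.sqrt ((D₁ : ℝ) * ((2 ^ i : ℕ) : ℝ)) * (((2 ^ i : ℕ) : ℝ) ^ (-(1 / 2 : ℝ)) + (D₁ : ℝ) ^ (-η) +
            ((D₁ : ℝ) ^ (-(1 / 2 : ℝ)) + ((2 ^ i : ℕ) : ℝ) ^ (-η))))
        = (C * q * Real.sqrt (∑ d ∈ Ioc D₁ (2 * D₁), a' d ^ 2) *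
          Real.sqrt (∑ m ∈ Ioc (2 ^ i) (2 * 2 ^ i), b' m ^ 2) * Real.sqrt ((D₁ : ℝ) * ((2 ^ i : ℕ) : ℝ))) *
          (((2 ^ i : ℕ) : ℝ) ^ (-(1 / 2 : ℝ)) + (D₁ : ℝ) ^ (-η) +
            ((D₁ : ℝ) ^ (-(1 / 2 : ℝ)) + ((2 ^ i : ℕ) : ℝ) ^ (-η))) := by ring
      _ ≤ (C * q * (A * Real.sqrt D₁) * (B * Real.sqrt ((2 ^ i : ℕ) : ℝ)) *
          (Real.sqrt D₁ * Real.sqrt ((2 ^ i : ℕ) : ℝ))) * (2 * (((2 : ℝ) ^ i) ^ (-η') + (U : ℝ) ^ (-η'))) :=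
          mul_le_mul hmass hsav hpos0 (by positivity)
      _ = 2 * C * q * A * B * (Real.sqrt (D₁ : ℝ) * Real.sqrt D₁) *
          ((Real.sqrt ((2 ^ i : ℕ) : ℝ) * Real.sqrt ((2 ^ i : ℕ) : ℝ)) * (((2 : ℝ) ^ i) ^ (-η') + (U : ℝ) ^ (-η'))) := by
          ring
      _ = 2 * C * q * A * B * D₁ * (((2 : ℝ) ^ i) ^ (1 - η') + (2 : ℝ) ^ i * (U : ℝ) ^ (-η')) := by
          rw [hDD, h22, mul_add ((2 : ℝ) ^ i), show (1 - η' : ℝ) = 1 + (-η') by ring,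
            Real.rpow_add (by positivity) 1 (-η'), Real.rpow_one]
  -- Step 4: sum the pieces
  have hgeom := sum_range_rpow_two_pow_le hη'0.le hη'h hN1
  have h2sum : ∑ i ∈ range L, (2 : ℝ) ^ i ≤ 2 * N := by
    rw [geom_sum_eq (by norm_num : (2 : ℝ) ≠ 1)]
    have h2L : (2 : ℝ) ^ L ≤ 2 * N := by
      rw [hL, pow_succ]
      have : ((2 ^ Nat.log 2 N : ℕ) : ℝ) ≤ N := by exact_mod_cast Nat.pow_log_le_self 2 (by omega : N ≠ 0)
      push_cast at this
      linarith
    norm_num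
    linarith
  have htail : |∑ i ∈ range L, ∑ d ∈ Ioc D₁ (2 * D₁), ∑ m ∈ Ioc (2 ^ i) (2 * 2 ^ i), a' d * b' m * c d m| ≤
      2 * C * q * A * B * D₁ * (5 * (N : ℝ) ^ (1 - η') + 2 * N * (U : ℝ) ^ (-η')) := by
    refine (abs_sum_le_sum_abs _ _).trans ((sum_le_sum hpiece).trans ?_)
    rw [← mul_sum, sum_add_distrib, ← sum_mul]
    refine mul_le_mul_of_nonneg_left (add_le_add hgeom ?_) (by positivity)
    exact mul_le_mul_of_nonneg_right h2sum (by positivity)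
  -- Step 5: collect, using `N ≥ U/2 ≥ 1`, `D₁ ≥ U`
  have hNpow : (N : ℝ) ^ (1 - η') = N * (N : ℝ) ^ (-η') := by
    rw [show (1 - η' : ℝ) = 1 + (-η') by ring, Real.rpow_add hN0, Real.rpow_one]
  have hV1 : (1 : ℝ) ≤ ((U / 2 : ℕ) : ℝ) := by exact_mod_cast (by omega : 1 ≤ U / 2)
  have hVN' : (((U / 2 : ℕ) : ℝ)) ≤ N := by exact_mod_cast hVN
  have hsN : (N : ℝ) ^ (-η') ≤ ((U / 2 : ℕ) : ℝ) ^ (-η') :=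
    Real.rpow_le_rpow_of_nonpos (by linarith) hVN' (by linarith)
  have hN1' : (1 : ℝ) ≤ N := by exact_mod_cast hN1
  have hinvN : (1 : ℝ) ≤ N * (N : ℝ) ^ (-η') := by
    have : (N : ℝ) ^ (-(1 : ℝ)) ≤ (N : ℝ) ^ (-η') :=
      Real.rpow_le_rpow_of_exponent_le hN1' (by linarith)
    rw [Real.rpow_neg hN0.le, Real.rpow_one] at this
    calc (1 : ℝ) = N * (N : ℝ)⁻¹ := by field_simp
      _ ≤ N * (N : ℝ) ^ (-η') := mul_le_mul_of_nonneg_left this hN0.le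
  set V : ℝ := ((U / 2 : ℕ) : ℝ) ^ (-η') with hV
  set Y : ℝ := (U : ℝ) ^ (-η') with hY
  have hV0 : 0 ≤ V := by positivity
  have hY0 : 0 ≤ Y := by positivity
  have hABD : 0 ≤ A * B * D₁ := by positivity
  have hCq : 0 ≤ C * q := by positivity
  calc |∑ d ∈ Ioc D₁ (2 * D₁), a' d * (b 1 * c d 1) +
        ∑ i ∈ range L, ∑ d ∈ Ioc D₁ (2 * D₁), ∑ m ∈ Ioc (2 ^ i) (2 * 2 ^ i), a' d * b' m * c d m|
      ≤ A * B * D₁ + 2 * C * q * A * B * D₁ * (5 * (N : ℝ) ^ (1 - η') + 2 * N * (U : ℝ) ^ (-η')) :=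
        (abs_add_le _ _).trans (add_le_add hhead htail)
    _ = A * B * D₁ * (1 + C * q * (10 * (N * (N : ℝ) ^ (-η')) + 4 * (N * Y))) := by rw [hNpow]; ring
    _ ≤ A * B * D₁ * (N * (N : ℝ) ^ (-η') + C * q * (10 * (N * (N : ℝ) ^ (-η')) + 4 * (N * Y))) := by
        gcongr
    _ ≤ A * B * D₁ * (N * V + C * q * (10 * (N * V) + 4 * (N * Y))) := by
        have h1 : (N : ℝ) * (N : ℝ) ^ (-η') ≤ N * V := mul_le_mul_of_nonneg_left hsN hN0.le
        have h2 : C * q * (10 * (N * (N : ℝ) ^ (-η')) + 4 * (N * Y)) ≤ C * q * (10 * (N * V) + 4 * (N * Y)) :=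
          mul_le_mul_of_nonneg_left (by linarith) hCq
        exact mul_le_mul_of_nonneg_left (add_le_add h1 h2) hABD
    _ ≤ A * B * ((10 * C + 1) * q * (V + Y)) * D₁ * N := by
        have hNV : 0 ≤ (N : ℝ) * V := by positivity
        have hNY : 0 ≤ (N : ℝ) * Y := by positivity
        have hgoal : N * V + C * q * (10 * (N * V) + 4 * (N * Y)) ≤ (10 * C + 1) * q * (V + Y) * N := by
          nlinarith [mul_nonneg hCq hNY, mul_nonneg hCq hNV, mul_le_mul_of_nonneg_right hq1 hNV,
            mul_le_mul_of_nonneg_right hq1 hNY]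
        calc A * B * D₁ * (N * V + C * q * (10 * (N * V) + 4 * (N * Y)))
            ≤ A * B * D₁ * ((10 * C + 1) * q * (V + Y) * N) := mul_le_mul_of_nonneg_left hgoal hABD
          _ = _ := by ring

end Summit.Parity.GeneralizedHardyLittlewood.Theorems.TypeIIToLevel

end
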